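import Mathlib
import HarnessLib

/-!
# TwoNotchPairKinematics — adjacent-pair kinematics, the (+,+)-adjacency clock and the FIFO shift law of the PERMISSIVE book
# (STAGING; nogo gen 19, `PBOOK-ADDENDUM-2.md` §3 lemmas L7–L10)

search for candidate a priori estimates; no regularity claim.

Setting (prose dictionary, as in `TwoNotchVacuumPhaseLock` / `TwoNotchExactDescent`): chords of the K book move with
`dx/dy = v = −T(mid-state)` for a velocity law `T` (model: `T = tan`; the `anyLaw` section holds for ANY `T` strictly increasing on a
set `I` containing the two mid-states involved). Two ADJACENT chords with the director value `θ` between them, the left one raising the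
director by `α` (its left state is `θ − α`, mid-state `θ − α/2`), the right one by `β` (right state `θ + β`, mid-state `θ + β/2`), have
`d(gap)/dy = v_right − v_left = T(θ − α/2) − T(θ + β/2) =: gapRate T θ α β`.

What is formalised (everything elementary, `[ours]`):
* `gapRate_neg_iff` / `gapRate_pos_iff` / `gapRate_eq_zero_iff` — L7: an adjacent pair APPROACHES iff `α + β > 0`, SEPARATES iff `α + β < 0`,
  is RIGID iff `α + β = 0`. Corollaries: both neighbours of a `+d` main approach it (`toward_plusMain_left/right`), both neighbours of a `−d`
  main recede (`from_minusMain_left/right`), two adjacent plus-chords approach (`plus_plus_approach`), two adjacent minus-chords separate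
  (`minus_minus_recede`), an opposite equal pair is rigid (`opposite_pair_rigid`, law-free), a top plateau `[+a, −b]` shrinks iff `b < a`
  (`topPlateau_shrinks_iff`), a bottom plateau `[−a, +b]` shrinks iff `a < b` (`bottomPlateau_shrinks_iff`).
* `tan_window_ge` — for the model law: `tan(φ + s) − tan(φ − s) ≥ 2 tan s` (`0 ≤ s`, `φ ± s ∈ (−π/2, π/2)`): the approach rate of a (+,+)
  adjacency of levels `a, b` is at least `2 tan((a+b)/4)` uniformly in the tilt (L8, the (+,+)-CLOCK, `tan_plus_plus_rate`), and
  `lifetime_bound` — a nonnegative gap closing at rate ≥ r lasts at most `g₀/r`.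
* `fifo_shift_periodic` — L10 (FIFO SHIFT LAW): with sibling pairing from the new end and death pairing from the old end of the two channels,
  the sign word of the longer channel is periodic with period `|I_t|` on the overlap.
* `alternating_partial_sum` — partial sums of an alternating sign word take only the values `0` and `x 0` (used in L10's window bound).
Nothing is claimed about Navier–Stokes. The kinematic bookkeeping (which chords are adjacent when) is prose (ADDENDUM-2 §3).
-/

noncomputable section

namespace Summit.NavierStokesRegularity.FunctionalMining.TwoNotchPairKinematics

/-- `d(gap)/dy` between two adjacent chords under `v = −T(mid)`: left chord step `α` (mid `θ − α/2`), right chord step `β` (mid `θ + β/2`). -/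
def gapRate (T : ℝ → ℝ) (θ α β : ℝ) : ℝ := T (θ - α / 2) - T (θ + β / 2)

/-- An opposite equal pair `(+a, −a)` is rigid for EVERY law (no monotonicity needed). -/
theorem opposite_pair_rigid (T : ℝ → ℝ) (θ a : ℝ) : gapRate T θ a (-a) = 0 := by
  unfold gapRate
  rw [show θ + -a / 2 = θ - a / 2 by ring]
  exact sub_self _

/-- Likewise `(−a, +a)`. -/
theorem opposite_pair_rigid' (T : ℝ → ℝ) (θ a : ℝ) : gapRate T θ (-a) a = 0 := by
  unfold gapRate
  rw [show θ - -a / 2 = θ + a / 2 by ring]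
  exact sub_self _

section anyLaw

variable {T : ℝ → ℝ} {I : Set ℝ}

/-- L7: the pair APPROACHES (gap strictly decreasing) iff `α + β > 0`. -/
theorem gapRate_neg_iff (hT : StrictMonoOn T I) (θ α β : ℝ) (h₁ : θ - α / 2 ∈ I) (h₂ : θ + β / 2 ∈ I) :
    gapRate T θ α β < 0 ↔ 0 < α + β := by
  unfold gapRate
  rw [sub_neg, hT.lt_iff_lt h₁ h₂]
  constructor <;> intro h <;> linarith

/-- L7: the pair SEPARATES iff `α + β < 0`. -/
theorem gapRate_pos_iff (hT : StrictMonoOn T I) (θ α β : ℝ) (h₁ : θ - α / 2 ∈ I) (h₂ : θ + β / 2 ∈ I) :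
    0 < gapRate T θ α β ↔ α + β < 0 := by
  unfold gapRate
  rw [sub_pos, hT.lt_iff_lt h₂ h₁]
  constructor <;> intro h <;> linarith

/-- L7: the pair is RIGID iff `α + β = 0`. -/
theorem gapRate_eq_zero_iff (hT : StrictMonoOn T I) (θ α β : ℝ) (h₁ : θ - α / 2 ∈ I) (h₂ : θ + β / 2 ∈ I) :
    gapRate T θ α β = 0 ↔ α + β = 0 := by
  unfold gapRate
  rw [sub_eq_zero, hT.injOn.eq_iff h₁ h₂]
  constructor <;> intro h <;> linarith

/-- Both neighbours of the `+d` main `P` approach it: the LEFT neighbour (any step `α > −d`, e.g. `|α| < d`). -/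
theorem toward_plusMain_left (hT : StrictMonoOn T I) (θ α d : ℝ) (hα : -d < α)
    (h₁ : θ - α / 2 ∈ I) (h₂ : θ + d / 2 ∈ I) : gapRate T θ α d < 0 :=
  (gapRate_neg_iff hT θ α d h₁ h₂).2 (by linarith)

/-- … and the RIGHT neighbour of `P` (any step `β > −d`). -/
theorem toward_plusMain_right (hT : StrictMonoOn T I) (θ d β : ℝ) (hβ : -d < β)
    (h₁ : θ - d / 2 ∈ I) (h₂ : θ + β / 2 ∈ I) : gapRate T θ d β < 0 :=
  (gapRate_neg_iff hT θ d β h₁ h₂).2 (by linarith)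

/-- Both neighbours of the `−d` main `M` recede from it: the LEFT neighbour (any step `α < d`). -/
theorem from_minusMain_left (hT : StrictMonoOn T I) (θ α d : ℝ) (hα : α < d)
    (h₁ : θ - α / 2 ∈ I) (h₂ : θ + -d / 2 ∈ I) : 0 < gapRate T θ α (-d) :=
  (gapRate_pos_iff hT θ α (-d) h₁ h₂).2 (by linarith)

/-- … and the RIGHT neighbour of `M` (any step `β < d`). -/
theorem from_minusMain_right (hT : StrictMonoOn T I) (θ d β : ℝ) (hβ : β < d)
    (h₁ : θ - -d / 2 ∈ I) (h₂ : θ + β / 2 ∈ I) : 0 < gapRate T θ (-d) β :=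
  (gapRate_pos_iff hT θ (-d) β h₁ h₂).2 (by linarith)

/-- Two adjacent PLUS chords (levels `a, b > 0`) approach each other, whatever the director value between them. -/
theorem plus_plus_approach (hT : StrictMonoOn T I) (θ a b : ℝ) (ha : 0 < a) (hb : 0 < b)
    (h₁ : θ - a / 2 ∈ I) (h₂ : θ + b / 2 ∈ I) : gapRate T θ a b < 0 :=
  (gapRate_neg_iff hT θ a b h₁ h₂).2 (by linarith)

/-- Two adjacent MINUS chords separate. -/
theorem minus_minus_recede (hT : StrictMonoOn T I) (θ a b : ℝ) (ha : 0 < a) (hb : 0 < b)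
    (h₁ : θ - -a / 2 ∈ I) (h₂ : θ + -b / 2 ∈ I) : 0 < gapRate T θ (-a) (-b) :=
  (gapRate_pos_iff hT θ (-a) (-b) h₁ h₂).2 (by linarith)

/-- A TOP plateau `[+a, −b]` (the director value `θ` on it is a local maximum) shrinks iff its plus wall is the larger level. -/
theorem topPlateau_shrinks_iff (hT : StrictMonoOn T I) (θ a b : ℝ)
    (h₁ : θ - a / 2 ∈ I) (h₂ : θ + -b / 2 ∈ I) : gapRate T θ a (-b) < 0 ↔ b < a := by
  rw [gapRate_neg_iff hT θ a (-b) h₁ h₂]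
  constructor <;> intro h <;> linarith

/-- A BOTTOM plateau `[−a, +b]` shrinks iff its plus wall is the larger level. -/
theorem bottomPlateau_shrinks_iff (hT : StrictMonoOn T I) (θ a b : ℝ)
    (h₁ : θ - -a / 2 ∈ I) (h₂ : θ + b / 2 ∈ I) : gapRate T θ (-a) b < 0 ↔ a < b := by
  rw [gapRate_neg_iff hT θ (-a) b h₁ h₂]
  constructor <;> intro h <;> linarith

end anyLaw

/-! ## The model law `T = tan`: the (+,+)-clock is uniform in the tilt -/

/-- `tan` instance of L7. -/
theorem tan_gapRate_neg_iff (θ α β : ℝ)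
    (h₁ : -(Real.pi / 2) < θ - α / 2) (h₁' : θ - α / 2 < Real.pi / 2)
    (h₂ : -(Real.pi / 2) < θ + β / 2) (h₂' : θ + β / 2 < Real.pi / 2) :
    gapRate Real.tan θ α β < 0 ↔ 0 < α + β :=
  gapRate_neg_iff Real.strictMonoOn_tan θ α β ⟨h₁, h₁'⟩ ⟨h₂, h₂'⟩

/-- L8 (the (+,+)-CLOCK, uniform in the tilt): `2 tan s ≤ tan (φ + s) − tan (φ − s)` for `0 ≤ s` and `φ ± s ∈ (−π/2, π/2)`.
With `φ = θ + (β − α)/4`, `s = (α + β)/4` this bounds the approach rate `−gapRate tan θ α β` of a (+,+) adjacency from below by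
`2 tan((α+β)/4) > 0`, independently of `θ`. Proof: `(tan A − tan B)·cos A cos B = sin(A − B) = sin 2s` and `cos A cos B =
cos²φ cos²s − sin²φ sin²s ≤ cos²s`. -/
theorem tan_window_ge (φ s : ℝ) (hs : 0 ≤ s) (hlo : -(Real.pi / 2) < φ - s) (hhi : φ + s < Real.pi / 2) :
    2 * Real.tan s ≤ Real.tan (φ + s) - Real.tan (φ - s) := by
  have hA : 0 < Real.cos (φ + s) := Real.cos_pos_of_mem_Ioo ⟨by linarith, hhi⟩
  have hB : 0 < Real.cos (φ - s) := Real.cos_pos_of_mem_Ioo ⟨hlo, by linarith⟩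
  have hC : 0 < Real.cos s := Real.cos_pos_of_mem_Ioo ⟨by linarith [Real.pi_pos], by linarith⟩
  have hS : 0 ≤ Real.sin s := Real.sin_nonneg_of_nonneg_of_le_pi hs (by linarith [Real.pi_pos])
  have hP : 0 < Real.cos (φ + s) * Real.cos (φ - s) := mul_pos hA hB
  have h1 : (Real.tan (φ + s) - Real.tan (φ - s)) * (Real.cos (φ + s) * Real.cos (φ - s)) = Real.sin (2 * s) := by
    have e1 := Real.tan_mul_cos hA.ne'
    have e2 := Real.tan_mul_cos hB.ne'
    have e3 : Real.sin (2 * s) = Real.sin ((φ + s) - (φ - s)) := by congr 1; ring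
    rw [e3, Real.sin_sub]
    calc (Real.tan (φ + s) - Real.tan (φ - s)) * (Real.cos (φ + s) * Real.cos (φ - s))
        = (Real.tan (φ + s) * Real.cos (φ + s)) * Real.cos (φ - s)
            - (Real.tan (φ - s) * Real.cos (φ - s)) * Real.cos (φ + s) := by ring
      _ = Real.sin (φ + s) * Real.cos (φ - s) - Real.cos (φ + s) * Real.sin (φ - s) := by rw [e1, e2]; ring
  have h2 : Real.cos (φ + s) * Real.cos (φ - s) ≤ Real.cos s ^ 2 := by
    rw [Real.cos_add, Real.cos_sub]
    nlinarith [Real.sin_sq_add_cos_sq φ, Real.sin_sq_add_cos_sq s, sq_nonneg (Real.sin φ * Real.sin s),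
      sq_nonneg (Real.cos s * Real.sin φ)]
  have h3 : Real.sin (2 * s) = 2 * Real.sin s * Real.cos s := Real.sin_two_mul s
  have hD : Real.tan (φ + s) - Real.tan (φ - s) = Real.sin (2 * s) / (Real.cos (φ + s) * Real.cos (φ - s)) := by
    rw [eq_div_iff hP.ne']; exact h1
  rw [hD, Real.tan_eq_sin_div_cos, le_div_iff₀ hP, h3]
  have hq : 0 ≤ 2 * (Real.sin s / Real.cos s) := by positivity
  calc 2 * (Real.sin s / Real.cos s) * (Real.cos (φ + s) * Real.cos (φ - s))
      ≤ 2 * (Real.sin s / Real.cos s) * Real.cos s ^ 2 := mul_le_mul_of_nonneg_left h2 hq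
    _ = 2 * Real.sin s * Real.cos s := by field_simp

/-- L8 applied: the approach rate of a (+,+) adjacency (`0 < α + β`, all mid-states in `(−π/2, π/2)`) is at least `2 tan((α+β)/4)`. -/
theorem tan_plus_plus_rate (θ α β : ℝ) (hαβ : 0 < α + β)
    (h₁ : -(Real.pi / 2) < θ - α / 2) (h₂ : θ + β / 2 < Real.pi / 2) :
    2 * Real.tan ((α + β) / 4) ≤ -gapRate Real.tan θ α β := by
  have key := tan_window_ge (θ + (β - α) / 4) ((α + β) / 4) (by linarith)
    (by rw [show θ + (β - α) / 4 - (α + β) / 4 = θ - α / 2 by ring]; exact h₁)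
    (by rw [show θ + (β - α) / 4 + (α + β) / 4 = θ + β / 2 by ring]; exact h₂)
  unfold gapRate
  rw [show θ + (β - α) / 4 + (α + β) / 4 = θ + β / 2 by ring,
      show θ + (β - α) / 4 - (α + β) / 4 = θ - α / 2 by ring] at key
  linarith

/-- L8 (lifetime): a gap that is nonnegative on `[0, Y]` and closes at rate at least `r > 0` from `g₀` satisfies `Y ≤ g₀ / r`. -/
theorem lifetime_bound (g : ℝ → ℝ) (g₀ r Y : ℝ) (hr : 0 < r) (hY : 0 ≤ Y)
    (hrate : ∀ y, 0 ≤ y → y ≤ Y → g y ≤ g₀ - r * y) (hpos : ∀ y, 0 ≤ y → y ≤ Y → 0 ≤ g y) :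
    Y ≤ g₀ / r := by
  have h₁ := hrate Y hY le_rfl
  have h₂ := hpos Y hY le_rfl
  rw [le_div_iff₀ hr]
  linarith

/-! ## The FIFO shift law and the alternating window -/

/-- L10 (FIFO SHIFT LAW). `x i`, `y i` = the signs of the `i`-th NEWEST t-chord of the channels X (arc M→P) and Y (arc P→M),
`m = #X ≥ m' = #Y`. Siblings (born together at `M`) have opposite signs — `y i = −x i` for `i < m'`; death partners (eaten together at `P`,
FIFO from the old end) have opposite signs — `x (m−1−j) = −y (m'−1−j)` for `j < m'`. THEN the sign word of X is periodic with period
`m − m'` (= |I_t|) on the overlap. -/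
theorem fifo_shift_periodic (x y : ℕ → ℤ) (m m' : ℕ) (hmm : m' ≤ m)
    (hsib : ∀ i, i < m' → y i = -x i) (hdeath : ∀ j, j < m' → x (m - 1 - j) = -y (m' - 1 - j)) :
    ∀ i, i < m' → x (i + (m - m')) = x i := by
  intro i hi
  have h := hdeath (m' - 1 - i) (by omega)
  have e1 : m - 1 - (m' - 1 - i) = i + (m - m') := by omega
  have e2 : m' - 1 - (m' - 1 - i) = i := by omega
  rw [e1, e2, hsib i hi] at h
  simpa using h

/-- An alternating sign word: `x (i+1) = −x i`. Its terms are `±x 0` by parity … -/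
theorem alternating_term (x : ℕ → ℤ) (halt : ∀ i, x (i + 1) = -x i) (k : ℕ) :
    x k = if Even k then x 0 else -x 0 := by
  induction k with
  | zero => simp
  | succ n ih =>
    rw [halt n, ih]
    by_cases hn : Even n
    · have : ¬ Even (n + 1) := by rw [Nat.even_add_one]; exact not_not.mpr hn
      simp [hn, this]
    · have : Even (n + 1) := by rw [Nat.even_add_one]; exact hn
      simp [hn, this]

/-- … and its partial sums take only the values `0` (even length) and `x 0` (odd length): the t-content of any window of an
alternating channel is `0` or `±t` (L10, window bound). -/
theorem alternating_partial_sum (x : ℕ → ℤ) (halt : ∀ i, x (i + 1) = -x i) (k : ℕ) :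
    (Finset.range k).sum x = if Even k then 0 else x 0 := by
  induction k with
  | zero => simp
  | succ n ih =>
    rw [Finset.sum_range_succ, ih, alternating_term x halt n]
    by_cases hn : Even n
    · have : ¬ Even (n + 1) := by rw [Nat.even_add_one]; exact not_not.mpr hn
      simp [hn, this]
    · have : Even (n + 1) := by rw [Nat.even_add_one]; exact hn
      simp [hn, this]

/-- L10(v) (THE |I_t| = 2 SECTOR ALTERNATES). If the sign word of the longer channel is 2-periodic (the FIFO shift law with
`m − m' = 2`) and two consecutive entries cancel (level-t balance: the two oldest t-chords of the longer channel are the unmatched ones,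
so their signs sum to zero), then the word ALTERNATES. Pure combinatorics on `ℕ → ℤ`. -/
theorem shift_two_balanced_alternates (x : ℕ → ℤ) (hper : ∀ i, x (i + 2) = x i) (m : ℕ)
    (hbal : x m + x (m + 1) = 0) : ∀ i, x (i + 1) = -x i := by
  have hev : ∀ k, x (2 * k) = x 0 ∧ x (2 * k + 1) = x 1 := by
    intro k
    induction k with
    | zero => simp
    | succ k ih =>
      constructor
      · rw [show 2 * (k + 1) = 2 * k + 2 by ring, hper (2 * k)]; exact ih.1
      · rw [show 2 * (k + 1) + 1 = (2 * k + 1) + 2 by ring, hper (2 * k + 1)]; exact ih.2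
  have h01 : x 0 + x 1 = 0 := by
    obtain ⟨k, hk | hk⟩ := Nat.even_or_odd' m
    · rw [hk, (hev k).1, (hev k).2] at hbal; exact hbal
    · rw [hk, (hev k).2, show 2 * k + 1 + 1 = 2 * (k + 1) by ring, (hev (k + 1)).1] at hbal; linarith
  intro i
  obtain ⟨k, hk | hk⟩ := Nat.even_or_odd' i
  · rw [hk, (hev k).1, (hev k).2]; linarith
  · rw [hk, (hev k).2, show 2 * k + 1 + 1 = 2 * (k + 1) by ring, (hev (k + 1)).1]; linarith

end Summit.NavierStokesRegularity.FunctionalMining.TwoNotchPairKinematics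

-- ops-buildfix-3 (2026-08-22): enqueue re-land; the build request of the 21:30:45Z accept was lost in the gate-reload window (no content change).
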